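import Mathlib
import HarnessLib
import HarnessLib.Audit
import Summits.Schanuel.Statement
import Literature.NumberTheory.Transcendental.LindemannWeierstrassProofs
import HarnessLib.Audit.Status.Attr

/-!
Route: DiophantineDichotomy

DORMANT since 2026-08-25T11:03:01Z (reconciler: no traction for 7.6 d (last activity item-evidence-added at 2026-08-17T19:13:08Z); parked, not closed — `ledger route dormant route-Schanuel-DiophantineDichotomy --off` to reactivate) — unstaffed, not closed; items shared with open routes are served there. `ledger route dormant <id> --off` reactivates.

# Route DiophantineDichotomy — Schanuel at free Khovanskii points as an exponent race between
eventual approximation type and Philippon's approximation property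

It suffices to show X = KhovanskiiSchanuel: for every n and every s ∈ ℂⁿ with ℚ-linearly independent
coordinates which is a
NON-DEGENERATE solution of a Khovanskii system g₁(z, e^z) = ⋯ = gₙ(z, e^z) = 0 over ℚ (exponential
Jacobian
det(∂gᵢ/∂zⱼ + yⱼ∂gᵢ/∂yⱼ)(s, e^s) ≠ 0), trdeg_ℚ ℚ(s, e^s) ≥ n — "free Khovanskii points are generic
points of their Khovanskii
variety" (trdeg ≤ n is automatic). X ⟺ Schanuel, and Schanuel ⟸ X is PROVED in tree (support
KhovanskiiReduction,
`khovanskiiReduction_proof` @ d99e6b8a9f30: a δ-minimal counterexample carries no partial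
E-derivation by Ax's rank term, so
the Khovanskii dichotomy makes it a free Khovanskii VECTOR). What the transfer buys is the ENTRANCE
CONDITION: the summit's
uncountably many tuples become countably many isolated, explicitly enumerable points θ = (s, e^s) ∈
ℂ²ⁿ, and at each of them
X(θ) is decided by a DIOPHANTINE EXPONENT RACE between two statements of PRINTED TYPE — an
eventual-in-the-height measure of
simultaneous algebraic approximation ‖γ − θ‖ ≥ exp(−C(dᵃ log H + dᵇ)) for H ≥ H₀(d), a < 1/(n−1)
(crux KhovanskiiApproxTypeEv:
the shape of Philippon1999ActaArith Thm 1 (2) / Bruiltet2002 Thm A, which PROVE such a measure with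
the generic exponent at
(π/ω, η/ω)), against Philippon's approximation property in transcendence degree t = n − 1 (crux
ApproximationProperty: t = 1
known, t = 2 printed, t = 3 printed modulo an interpolation clause, t ≥ 4 Philippon's conjecture) —
which together contradict trdeg ≤ n − 1 (support
ApproximationRaceEv: fix Δ, let Y → ∞). The all-heights measure KhovanskiiApproxType
(stmt-Schanuel-6116, the crux as
first filed; support since the promote pass 2026-08-16 because the race needs only its eventual
form, TypedImpliesEv) stays
in the file as the stronger statement its line height-window-compactness attacks by name. Card
realised:
liouville-diophantine-dichotomy (R3 = KhovanskiiReduction, R1 = KhovanskiiLocalInverse, C1/C2 = the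
two cruxes); flagship
instance n = 2 at s = (1, iπ): EPiSimultaneousTypeEv (eventual simultaneous measure for (π, e), a <
1) + the KNOWN t = 1
property ⇒ e ⊥ π (EPiRaceEv; the all-heights version EPiRace is PROVED, p83490).
Lean: `∀ (n : ℕ) (s : Fin n → ℂ), LinearIndependent ℚ s → (∃ g : Fin n → MvPolynomial (Fin n ⊕ Fin
n) ℚ, (∀ i, MvPolynomial.aeval (Sum.elim s (Complex.exp ∘ s)) (g i) = 0) ∧ (Matrix.of fun i j =>
MvPolynomial.aeval (Sum.elim s (Complex.exp ∘ s)) (MvPolynomial.pderiv (Sum.inl j) (g i) +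
MvPolynomial.X (Sum.inr j) * MvPolynomial.pderiv (Sum.inr j) (g i))).det ≠ 0) → (n : Cardinal) ≤
Algebra.trdeg ℚ ↥(IntermediateField.adjoin ℚ (Set.range s ∪ Set.range (Complex.exp ∘ s)))`

## Assembly
Deciding theorem (crux-only since the 2026-08-16 repair): `closes (hAP : ApproximationProperty) (hEv
: KhovanskiiApproxTypeEv)
(hRed : KhovanskiiReduction) : Schanuel` — hypotheses = the two ranked CRUXES + the PROVED
reduction; the eventual exponent
race (race compactness: fix Δ, let Y → ∞; Northcott finiteness for bounded degree and naive height
via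
`Polynomial.bUnion_roots_finite`; θ = (s, e^s) has a transcendental coordinate by Hermite–Lindemann)
is PROVED INLINE in the
body of `closes` (≈230 lines, planner Sketch.lean rc 0, axioms propext/Classical.choice/Quot.sound);
the support item
ApproximationRaceEv (stmt-Schanuel-14973) names the same implication and now follows from `closes` +
`khovanskiiReduction_proof`
in ten lines. The bookkeeping item Assembly (stmt-Schanuel-14920: ApproximationProperty →
KhovanskiiApproxType → Schanuel;
provable now: `khovanskiiReduction_proof (approximationRace_proof hAP hAT)`) states the summit from
the STRONGER all-heights
measure and stays true; the eventual form closes through `closes`.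

Rationale: WHY THIS LINE. Every known algebraic-independence theorem for values of the exponential or elliptic
functions is proved by a
method that also yields a MEASURE: Gel'fond's and Philippon's criteria, interpolation determinants
with multiplicities
(LaurentRoy1999TAMS, LaurentRoy2001) and Philippon's "approche méthodique" output statements of the
two shapes this route
races — codimension-one measures log|Q(θ)| ≥ −φ(deg Q, h(Q)) and SIMULTANEOUS APPROXIMATION MEASURES
Dist(θ, α) ≥
exp(−c·ψ(d(α), h(α))) — and the first is derived from the second at a point of known transcendence
degree (Philippon2000
transfer lemma; Bruiltet2002 Thm A ⇒ Thm B), while this route's spine derives the second from the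
first. Where the analytic method exists the measure comes WITH THE GENERIC EXPONENT:
Philippon1999ActaArith Thm 1
(2) (held, read p.114) gives Dist(θ, α) > exp(−c(h(α) + log d(α))·d(α)^{3/2}) at θ = (1 : π/ω : η/ω)
(trdeg 2, exponent
1 + 1/t = 3/2), Bruiltet2002 Thm A′ (held, p.244) the same for (Γ(1/4), π) with the explicit
constant 10^30 (and a log(1+d)
factor), Grinspan2002 for quasi-periods of abelian varieties. So asking for a measure instead of
bare independence costs no technique and buys the
RACE: the pointwise measure at countably many explicit points decides the whole summit
(KhovanskiiReduction, proved). The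
route's own LEVER, landed during the opening, is the DEGREE-EFFECTIVE CONVERSE TRANSFER,
codimension-one ⇒ simultaneous:
(1) KhovanskiiLocalInverse (proved @ 074fd9a481a7) turns ‖γ − θ‖ into max(|gᵢ(γ)|, |e^{γ_z} − γ_y|),
so exp is only ever
evaluated at ALGEBRAIC points; (2) a relative Siegel lemma INSIDE THE IDEAL OF THE CHALLENGER
(discriminant-free absolute
Siegel over ℚ(γ), `SiegelInIdeal` p76390 + box lemma p75708) and the mean value theorem
(`TransferOfSiegel` p76504, lemmas
p75356) convert any codimension-one measure with degree exponent μ at a transcendence basis θ_J ∈ ℂᵐ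
into a primitive
approximation measure with exponent p = (μ+1)/m; (3) the SLOT DICHOTOMY (`SlotDichotomyTwo` p75181):
pair measure (p) +
one-variable floors of exponent A ⇒ approximation type a = A·p/(A+1), i.e. a = A(μ+1)/(n(A+1)) — 3/4
at (n, μ, A) = (2, 2, 1);
composition `approxTypeAt_two_of_inputs` / `khovanskiiApproxType_of_parts` landed p78384; (4) RACE
COMPACTNESS (this pass;
ApproximationRaceEv, provable now): the race runs at FIXED Δ with Y → ∞, so the measure is consumed
only for H ≥ H₀(d) with
H₀ arbitrary — Mahler-type ineffective thresholds and Ably's height-free penalty exp(C Dᵐ log D) are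
harmless, and every
small-height phenomenon leaves the kill surface. Consequences, in numbers: at every
Lindemann–Weierstrass point (s ∈ ℚ̄ⁿ
lin. indep.: a free Khovanskii point with gᵢ = minpoly(zᵢ), Jacobian Π minpolyᵢ′(sᵢ) ≠ 0) the n = 2
layer of the Diophantine
crux is THEOREM-GRADE modulo vendoring one printed theorem: Ably1994 Thm p.30 (held, read:
log|P(e^y)| ≥ −c₂Dᵐ(log H + exp(CDᵐ log(D+1))), μ = m Dirichlet-optimal)
at m = 2 (the C⁺ input) and m = 1 (floors A = 1) ⇒ a = 3/4 < 1 through (2)–(3) re-run in Ably's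
penalty class (line
height-window-compactness, stubs `stub_penaltyTransfer`, `stub_penaltySlotDichotomy_two` provable
now, `stub_lwPenaltyMeasure`
= Ably vendored) — the first free Khovanskii points at which a crux-shaped item of this route
closes; at a non-LW n = 2
point the residual is NAMED in the native output format: an eventual codimension-one measure
log|Q(θ_J)| ≥ −C(D^μ log H + D^K),
H ≥ H₀(D), at the transcendence basis θ_J, with μ < 1 + 2/A against one-variable floors of exponent
A at both slots
(`NonLWInputsTwo`; Dirichlet forces μ ≥ 2, `CodimOneDirichlet` p84369, so floors with A < 2 are
themselves required). At the
flagship s = (1, iπ), θ_J = (π, e): A = 1 + o(1) for π (Waldschmidt1978;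
NesterenkoWaldschmidt1996_thm_2_2 vendored p82623) and
A = 1 eventually for e (Popken–Mahler, Bugeaud2004 p.83; Mahler1932 for every e^β), so the residual
is exactly 'log|Q(π, e)| ≥
−C(D^μ log H + D^K) for H ≥ H₀(D) with some μ ∈ [2, 3)' — Schanuel-rank-2 strength (it contains e ⊥
π), conceded, but a
statement of the precise type Philippon1999ActaArith Thm 1 (1) proves next door (exp(−c⁵(log H + d
log d)d²), μ = 2, at
(π/ω, η/ω)); at log points (log 2, log 3) only A = 2 is in print for log α (Fel'dman), so there a
floor A < 2 for logarithms is
part of the residual too; at the Nesterenko point s = (iπ, π) the printed measure is in the size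
currency (NP2001 Ch.3 Cor 5.2,
T⁴(log T)²⁴), not linear in log H — not in reach (IdeatorK2Notes C2). Imports: Diophantine
approximation / geometry of numbers (Siegel in the ideal, Mahler measures, Northcott finiteness),
transcendence (LW measures,
approximation property); exponential algebra only for the reduction (Ax, Khovanskii, Kirby). Why
this form is easier, in one
line: it replaces "trdeg ℚ(x, e^x) ≥ n for all x" by countably many pointwise statements each of
which has the SHAPE OF A
THEOREM IN PRINT (LW points: Ably/Mahler — now closed modulo vendoring; (π/ω, η/ω)-type points:
Philippon/Bruiltet), with
the plumbing from that shape to the summit kernel-checked.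

RANKED CRUXES. #0 KhovanskiiSchanuel (target) — Schanuel at free Khovanskii points (why it might
fail: ⟺ Schanuel; n = 1
Hermite–Lindemann, n = 2 contains e ⊥ π at s = (1, iπ) and log 2 ⊥ log 3). [Kirby2010, Ax1971,
Waldschmidt2004]
#2 KhovanskiiApproxTypeEv (crux, load-bearing since 2026-08-16) — EVENTUAL-in-the-height
simultaneous approximation type at
every free Khovanskii point θ = (s, e^s), n ≥ 2: ∃ a < 1/(n−1), b, C > 0 ∀ d ∃ H₀(d) ∀ H ≥ H₀(d): ‖γ
− θ‖ ≥ exp(−C(dᵃ log H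
+ dᵇ)) for all challengers γ ([ℚ(γ):ℚ] ≤ d, coordinates roots of non-zero integer polynomials of
degree ≤ d, height ≤ H)
(why it might fail: needs abnormally good approximations of UNBOUNDED height at BOUNDED degree to
fail — a Liouville-type
rigidity among isolated zeros of ℚ-systems, new if found; at non-LW n = 2 points it contains e ⊥ π
with a measure; for n ≥
3 the transfer architecture is capped at (n+1)/(2n) ≥ 1/(n−1) in the typed currency; expected truth
a = 1/n and a < 1/n is
refuted by AP(n) at θ — window [1/n, 1/(n−1))). [Ably1994, Mahler1932, Philippon1999ActaArith,
Bruiltet2002, Waldschmidt2004,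
NesterenkoPhilippon2001, RoyWaldschmidt1997, Bugeaud2004]
#3 ApproximationProperty (crux) — Philippon's approximation property in transcendence degree t,
output-dependent (d, log H)
form (why it might fail: load-bearing hypotheses kernel-checked by its disprover — `1 ≤ t` and
'uniform c' false (Shape
p75190), scale-prescribed exponent false at Liouville points (ScaleExponentLiouville p75561), `trdeg
≤ t` sharp at every
level (radical-Liouville (t+1)-tuples, TrdegForcing, pending); status: its line
orbit-interpolation-determinant reduces it
kernel-side to Philippon's 0-cycle property CycleAPIAt t — t = 1 LANDED (Dirichlet, p82894; point-AP
transfer p83127;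
lever OrbitClusterBound proved, p82123/p82135 landed), t = 2 = Philippon2000 (printed, NOT held:
acq-02318), t = 3 = the same
modulo an interpolation clause flagged by the deep-refute, t ≥ 4 = Philippon's AP1(d′ = 0)
conjecture; so on this side the
race is unconditional for n ≤ 3 modulo vendoring, nearly so for n = 4, conjectural for n ≥ 5).
[NesterenkoPhilippon2001, LaurentRoy1999, Philippon2000, Waldschmidt2004, RoyWaldschmidt1997]
Supports (rank 9 unless stated): KhovanskiiApproxType (stmt-6116; rank-2 slot kept, kind support
since this pass) — the
ALL-HEIGHTS measure, the crux as first filed; implies #2 (TypedImpliesEv, proved in Sketch.lean);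
its surplus over #2 at LW
points is exactly the height window exp(d^{b₀}) ≤ H < exp(exp(κ d log d)) (stub_lwWindow_two, open,
beyond print); line
height-window-compactness (7 registered stubs, lead prover-line-stmt-Schanuel-6116-0, disprover: no
kill, all three
hypotheses load-bearing p74852/p75268/p75553, constants non-uniform p74863) concludes it by name and
therefore serves #2 verbatim —
RE-KEY, do not restart, that chain. TypedImpliesEv — 6116 ⇒ #2 (trivial). ApproximationRaceEv —
ApproximationProperty →
KhovanskiiApproxTypeEv → KhovanskiiSchanuel (provable now; PROVED INLINE inside the crux-only
`closes` since the 2026-08-16 repair —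
as an item it follows from `closes` + `khovanskiiReduction_proof` in ten lines). ApproximationRace
(PROVED) — the
all-heights race, kept. KhovanskiiReduction (PROVED), KhovanskiiLocalInverse (PROVED), Assembly
(stmt-14920, restated bookkeeping:
ApproximationProperty → KhovanskiiApproxType → Schanuel, provable now).
ApproximationPropertyDegOne (stmt-11037, known: Diaz1997 = Bugeaud2004_thm_8_11 PROVED in tree
p52505 + lifting; closed
unconditionally by the t = 1 slice of #3's line once `stub_lift` lands). EPiSimultaneousType
(stmt-6118, support since the
unused-crux repair) / EPiSimultaneousTypeEv (this pass) — the s = (1, iπ) instances of 6116 / #2 for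
the pair (π, e);
EPiRace (PROVED p83490) / EPiRaceEv (provable now) — t = 1 property at (π, e) + the (eventual)
measure ⇒ e ⊥ π.
UNUSED-CRUX REPAIR (route-repair 2026-08-16, kept): EPiSimultaneousType is the s = (1, iπ) INSTANCE
of 6116 (both
directions kernel-checked, Theorems/EPiSimultaneousType/Negative/OfKhovanskiiApproxType.lean), so it
cannot feed `closes`
and is support; its decl stays because EPiRace, the EFloor/PiFloor lemmas and 11 Negative lemmas
name it. GROUND FLAG CLEARED (2026-08-16 06:47Z, ground-repair seat): the bookkeeping item Assembly
was restated
(stmt-6124 → stmt-14920) as ApproximationProperty → KhovanskiiApproxType → Schanuel (provable now,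
one line:
`khovanskiiReduction_proof (approximationRace_proof hAP hAT)`); `#h21_ground` is ok since rev 10 and
it is not load-bearing
(D-0027: `closes` decides the route).

TWO-LAYER PLAN. Foreseen glued split of #2 once its LW layer lands or the chain parks (decl names
reserved):
KhovanskiiApproxTypeEv ⇐ EvLindemannWeierstrass (s ∈ ℚ̄ⁿ; n = 2 provable now from vendored Ably1994
m = 1, 2 through the
landed spine — stubs 1–3 of line height-window-compactness) → EvRankTwo (non-LW n = 2: the
codimension-one residual μ < 1 +
2/A at the transcendence basis, or GraphMeasure(2) of card graph-uniform-lw — a θ-free uniform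
quantitative
Lindemann–Weierstrass over the challenger's own algebraic frequencies with kernel-checked transfer
`approxTypeAt_of_graphMeasure`, function-field model proved with a = 1/n) → EvRankThreeUp (n ≥ 3) →
KhovanskiiApproxTypeEv
(glue = case split, pure logic). Second foreseen move (package deal with #3, NOT filed while #3's
line is mid-flight): the
(d, h)-CURRENCY pair — KhovanskiiApproxTypeDhEv (exponent d^{1+a}·h(γ), SketchIdeator2.lean, 6116 ⇒
it proved) raced against
AP in Philippon's printed (d(α), d(α)h(α)) form (NesterenkoPhilippon2001 p.61 AP2): this is the
native currency of
Philippon1999ActaArith/Bruiltet2002/AP2, makes the LW layer printed for EVERY n with a = 1/n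
(Ably1994 + transfer) and dissolves
the typed cap at n ≥ 3. For #3: CycleAPIAt 1 (landed) → CycleAPIAt t, t ∈ {2,3} (vendoring
Philippon2000) → t ≥ 4
(Philippon's conjecture; sibling line arithmetic-chardin-philippon docks there).

KILL CRITERIA. (K1) #2 refuted ⇒ route refuted: by RaceEv the witness must be a free Khovanskii
point with algebraic
approximations of UNBOUNDED height at BOUNDED degree (a simultaneously-Liouville isolated zero of a
ℚ-system — a new
phenomenon, file it as a barrier) or of degree-exponent ≥ 1/(n−1) — at a Schanuel counterexample
every route dies. Small-
height witnesses (β-expansions, height-1 Littlewood roots, Ably's window) refute at most the support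
6116, which is then
dropped, not repaired. (K2) ¬EPiSimultaneousTypeEv ⇒ ¬#2 (instance), same rule. (K3) The disprover's
landed negatives bound #2 without threatening
it: Diaz along ONE slot kills every a < 1 (any proof must charge two independent slots; LoadBearing
p74852), constants
cannot be uniform in θ (NonUniform p74863), the Khovanskii hypothesis is load-bearing
(ultra-Liouville s = (log 2, r log 2),
LiouvilleTower p75261 / p75268 / p75553); the exponent floor a ≥ 1/n (AP(n) at θ) is printed, not
yet formalised. (K4) #3 false for some t ≥ 4
(Philippon's conjecture) ⇒ only n ≥ 5 is affected: pivot #3 to the sequence form of GL326 Conj 15.31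
(infinitely many
scales), which still races at fixed Δ. Schanuel proved elsewhere moots X; e ⊥ π proved elsewhere
moots the flagship pair as
targets only.

NOT DECOMPOSED YET. The split of #2 above (until stubs 1–3 land); the (d, h)-currency pair;
GraphMeasure / roy-transport
re-cuts of the non-LW layer (cards Cruxes/KhovanskiiApproxType/Ideas/{graph-uniform-lw,
roy-transport}.md, untriaged —
an ALTERNATIVE decomposition, hence a separate route sharing #0/#3 if pursued); explicit (a, b, H₀)
at named points; the
comeagre half of the card (R2, Liouville tuples — exactly the PolyLinIndep-failure locus of
graph-uniform-lw); p-adic or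
several-place measures; the t = 2, 3 vendoring of Philippon2000 (blocked on acq-02318).

CHEAPEST FALSIFIER. Now that the LW layer is settled positively (Ably1994 read: μ = m IS in print,
eventually in H, so the
former falsifier "no a < 1 measure at s = (1, √2)" is answered — a = 3/4 there), the cheapest live
check is ARITHMETIC on
the non-LW residual at the flagship: does any printed or in-tree statement give log|Q(π, e)| ≥
−C(D^μ log H + D^K)
eventually in H for some μ < 3? (Expected: no — it contains e ⊥ π; confirming this in one grounder
pass certifies #2 at
(1, iπ) as exactly Schanuel-rank-2 and pins the route's live provable content to: LW layer + RaceEv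
+ EPiRaceEv + the #3
reduction.) Second cheapest: run AP(2)-type counting at an LW point to confirm no challenger family
beats d^{1/2} by a power
(the route-review floor a ≥ 1/n, not yet formalised: needs AP(2), printed).

NUMBERS. Race window at a free Khovanskii point of ℂⁿ: a ∈ [1/n, 1/(n−1)) (floor: AP(n) at θ; need:
race vs AP(n−1)).
Transfer: a = A(μ+1)/(n(A+1)); n = 2: (μ, A) = (2, 1) ⇒ 3/4; window A(μ+1) < 2(A+1) (μ = 2 ⇒ A < 2;
A = 1 ⇒ μ < 3); n ≥ 3:
cap (n+1)/(2n) ≥ 1/(n−1) (triage W.lean). Dirichlet floors: μ ≥ m (CodimOneDirichlet p84369), A ≥ 1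
(SlotFloorDirichlet
p75841). Printed inputs: Ably1994 Thm p.30 log|P(e^y)| ≥ −c₂Dᵐ(log H + exp(CDᵐlog(D+1))), all P ≠ 0,
y ∈ ℚ̄ᵐ lin. indep.;
Mahler1932 Φ ≥ H^{−c(y)Dᵐ} for H ≥ H₀(D, y); Nesterenko1977 threshold log log H > CD^{2m}log(D+1);
π: Waldschmidt1978 /
Bugeaud2004 §8.3 3·2^38 d(log M + d log d)(1 + log d) (A = 1 + o(1)); Diaz1997 = Bugeaud2004 Thm
8.11 (PROVED in tree):
|ξ − α| ≤ exp(−0.006(n log M(α) + deg α log M)), n ≥ 50 — kills a < 1 along one slot. Model theorems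
for #2's shape:
Philippon1999ActaArith Thm 1 (2) exp(−c(h + log d)d^{3/2}) and (1) exp(−c⁵(log H + d log d)d²) at
(π/ω, η/ω); Bruiltet2002
Thm A′/B′ constants 10^30 / 10^326; Philippon1999ActaArith Cor 5 (K-functions, (π, e^π)-world): only
exp(−c(t d)^{4/3}log(t d)),
size currency — not linear in h, hence the Nesterenko point (iπ, π) is NOT yet in reach
(IdeatorK2Notes C2). AP: t = 1 known
(Diaz; LaurentRoy1999 Thm 1), t = 2 printed (Philippon2000 AP2 for ℙ²: d(α) ≤ (c′Δ)², d(α)h(α) ≤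
c′²HΔ, log Dist ≤ −c′d(α)(h(α)Δ
+ H)), t = 3 printed as AP1(d′ = 0) modulo the point transfer now in tree, t ≥ 4 open. Items after
this pass: 15 (2 cruxes, 1 target, 1 assembly, 11 support; 5 closed).

SOURCES. HELD (lit keys) and read at the cited pages: Ably1994 (paper:doi-10-4064-aa-67-1-29-45),
Philippon1999ActaArith
(paper:doi-10-4064-aa-88-2-113-127, fetched this pass), Bruiltet2002 (paper:doi-10-4064-aa104-3-3),
Grinspan2002
(paper:doi-10-1006-jnth-2001-2733), NesterenkoPhilippon2001
(book:nesterenko2001-introduction-algebraic-independence-theory),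
Bugeaud2004 (book:bugeaud2004-approximation-by-algebraic-numbers), Chudnovsky1984 (book),
BakerTNT1975 (book:baker1975-…),
Waldschmidt1978 (OA, lit key in bib); read from open copies: LaurentRoy1999 (pp.27–31),
LaurentRoy1999TAMS (AMS OA),
Waldschmidt2004 (arXiv math/0312440, carries GL326 Conj 15.31), NesterenkoWaldschmidt1996 (arXiv
math/0002047), Kirby2010
(arXiv), Ax1971. NOT held (acquisition open; none blocks the items filed in this pass):
Philippon2000 (acq-02318 — blocks
only the t = 2, 3 vendoring of #3), Waldschmidt2000 = GL326 (cited through Waldschmidt2004),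
RoyWaldschmidt1997 (acq-01582),
LaurentRoy2001 (acq-03982), Mahler1932 (scan acq-04890; content quoted via Ably1994 p.29), Ably1989
(acq-02387, WANTED
re-filed this pass), Sert1999 (acq-04524).

DEFINITION REQUESTS. None: Khovanskii systems, degrees and heights are inlined over Mathlib
(`MvPolynomial.pderiv`,
`IntermediateField.adjoin`, integer polynomials of bounded degree and naive height) so that the
route file's import cone
is Mathlib + the Statement (13 project constants, 0 unproved). The line vocabulary (ApproxTypeAt,
CodimOneMeasure(X),
SlotFloor(X), PrimitiveApproxMeasure(X), ApproxTypePenAt, HasTranscendenceType) lives in the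
accepted
Theorems/DiophantineDichotomyDefs.lean and the skeleton; the eventual predicates (ApproxTypeEvAt,
KhovanskiiApproxTypeDhEv)
in Cruxes/KhovanskiiApproxType/SketchIdeator2.lean.

Novelty: Searches RUN. 2026-08-15 (opening planner): `lit search --source zbmath` ×4 (Laurent–Roy t = 1 →
LaurentRoy1999, LaurentRoy2001, RoyWaldschmidt1997; Philippon 2000 → Philippon2000; "measure of
simultaneous approximation algebraic independence transcendence degree" → Grinspan2002,
Bruiltet2002, Ably1989); `lit read` LaurentRoy1999 pp.27–31, Waldschmidt2004 p.14,
NesterenkoPhilippon2001 Ch.4 §4 pp.50–52/61, Ch.14–15, Bugeaud2004 pp.180–184; `lit frontier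
Schanuel --since 2020` (30 rows, nothing on approximation at exponential-algebraic points); `lit
bridges Schanuel --cross any`; `lit galaxy search "simultaneous approximation measure algebraic
independence exponential" --star all` (0 rows). 2026-08-16 (crux chain on KhovanskiiApproxType, 3
ideators + 3 triagers + 2 line planners + disprover): Ably1994 pp.29–30 read (Mahler1932 /
Nesterenko1977 quoted there), Waldschmidt1978 p.446/457, Chudnovsky1984 p.25–26,
NesterenkoWaldschmidt1996 (arXiv math/0002047), Bugeaud2004 p.83, NP2001 Ch.3 Cor 5.2 p.46; Sert1999
zbl 0935.11024 review (text wanted acq-04524); kit LLL/field scans j009964–66, j010335, j014708.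
2026-08-16 (this promote pass): `lit search` "Philippon Mesures d'approximation de valeurs de
fonctions analytiques" → doi:10.4064/aa-88-2-113-127 FETCHED and read pp.113–115, 121, 126 (now
held, bib Philippon1999ActaArith); Bruiltet2002 pp.243–245, 280 re-read (Thm A/A′/B′, refs
[11]–[13]); `lit read 10.5802/afst.678` (Ably1989) → no OA copy (acq-02387, WANTED re-filed);
`ledger  [refs: 10.4064/aa-88-2-113-127, 10.5802/afst.678`, math/0002047, 1312.7154, doi:10.4064/aa-88-2-113-127, LaurentRoy1999, LaurentRoy2001, RoyWaldschmidt1997, Philippon2000, Grinspan2002, Bruiltet2002, Ably1989, Waldschmidt2004, NesterenkoPhilippon2001, Bugeaud2004, Ably1994, Mahler1932, Nesterenko1977, Waldschmidt1978, Chudnovsky1984, NesterenkoWaldschmidt1996, Kirby2010]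

Barriers (technique_class: approximation-type, approximation-property, khovanskii): - technique_class: approximation-type, approximation-property, khovanskii, lw-measure-transfer,
siegel-in-ideal
- Literature.Barriers.Schanuel.LargeTranscendenceDegree (technical hypothesis / several-variable
Gel'fond–Schneider): it does not bite the landed spine (no auxiliary function at a transcendental
point: Siegel inside the ideal of the ALGEBRAIC challenger + mean value + slot dichotomy) nor the LW
layer (trdeg known, Ably1994); it bites crux KhovanskiiApproxTypeEv exactly at its non-LW residual
(an eventual codimension-one measure μ < 1 + 2/A at a transcendence basis ⊇ e ⊥ π at (1, iπ)) and at
n ≥ 3 — conceded and NAMED; the bet is that the residual has the shape of a theorem in print next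
door (Philippon1999ActaArith Thm 1 at (π/ω, η/ω), μ = 2) and that the race needs it only eventually
in H (RaceEv), i.e. in the regime where every printed LW/HL measure already lives.
- Literature.Barriers.Schanuel.EFunctionValuesAtAlgebraicPoints: respected and used positively — exp
is only ever evaluated at ALGEBRAIC points (KhovanskiiLocalInverse turns ‖γ − θ‖ into maxⱼ|e^{γ_zⱼ}
− γ_yⱼ|; Ably/Mahler are LW at e^{algebraic}); the foreseen θ-free re-cut GraphMeasure (card
graph-uniform-lw: uniform quantitative LW over the challenger's own frequencies, transfer
kernel-checked) moves the whole non-LW layer INSIDE the barrier's positive scope, at the price of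
uniformity in the frequency field.
- Literature.Barriers.Schanuel.AlgebraicIndependenceOfLogarithms: applies to the target at log

History (route lifecycle, newest last):
- 2026-08-15T16:22:36Z · rev 2: restated EPiRace (stmt-Schanuel-6123) — staffability repair (route-repair rbadge g2): EPiRace (support, stmt-6123) restated 1:1 with its conclusion Literature…ExpOnePiAlgebraicIndependent UNFOLDED to (planner-rbadge-Schanuel-DiophantineDichotomy-368da08b-g2-0)
- 2026-08-15T16:36:40Z · rev 3: restated EPiRace (stmt-Schanuel-10737) — cone repair (route-repair rrepair-…-368da08b): (1) imports := [] — import Literature.NumberTheory.Transcendental.KhovanskiiDichotomy DROPPED; its only use was t (planner-rrepair-Schanuel-DiophantineDichotomy-368da08b-0)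
- 2026-08-15T16:38:42Z · rev 3: restated ApproximationPropertyDegOne (stmt-Schanuel-6122) — render-order repair 1/2 (route-repair rbadge g2): ApproximationPropertyDegOne restated 1:1 (sole change: ≤ (1 : Cardinal) ↦ ≤ 1, Iff.rfl, Sketch2.lean rc0) so t (planner-rbadge-Schanuel-DiophantineDichotomy-368da08b-g2-0)
- 2026-08-15T16:43:02Z · rev 5: dropped stmt-Schanuel-11045 — drop duplicate EPiRace filing stmt-Schanuel-11045 (mine, 16:41:36Z): the concurrent cone-repair seat re-filed EPiRace one minute earlier as stmt-Schanuel-11044 (planner-rbadge-Schanuel-DiophantineDichotomy-368da08b-g2-0)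
- 2026-08-16T06:47:20Z · rev 8: restated Assembly (stmt-Schanuel-6124 proved) — route-repair (ground-failed, rground 368da08b): restate the bookkeeping item Assembly (stmt-Schanuel-6124, kind assembly rank 1, proved by Theorems/DiophantineD (planner-rground-Schanuel-DiophantineDichotomy-368da08b-0)
- 2026-08-25T11:03:01Z · DORMANT — reconciler: no traction for 7.6 d (last activity item-evidence-added at 2026-08-17T19:13:08Z); parked, not closed — `ledger route dormant route-Schanuel-Diophan (operator:999:2608948)

sub-problem: Schanuel · status: dormant · opened planner-plancard-Schanuel-Schanuel-liouville--64c27fee-0 2026-08-15T11:44:40Z · rev 13 · ledger route-Schanuel-DiophantineDichotomy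
GENERATED by the gate from the ledger (D-0016/17). Provers cite these decls: `theorem foo : Summit.Schanuel.Schanuel.Theses.DiophantineDichotomy.<Decl> := …` in Summits/Schanuel/Schanuel/Theorems/<Name>.lean.
-/

namespace Summit.Schanuel.Schanuel.Theses.DiophantineDichotomy

open scoped BigOperators Topology Manifold Classical MeasureTheory ProbabilityTheory Matrix InnerProductSpace ComplexConjugate ContinuousMap
open Filter Set Function TopologicalSpace MeasureTheory

attribute [summit_statement] _root_.Schanuel

open Literature.Periods

/-- item stmt-Schanuel-6115 · target · rank 0 · open · by planner
why it might fail: X ⟺ Schanuel (KhovanskiiReduction + trivial converse), so it fails iff Schanuel fails; n = 1 is Hermite–Lindemann, n = 2 already contains e ⊥ π at s = (1, iπ) and log 2 ⊥ log 3 at s = (log 2, log 3).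
sources: Kirby2010, Ax1971, Waldschmidt2004, arXiv:1312.7154
[target] Schanuel's conjecture at free Khovanskii points: s ∈ ℂⁿ ℚ-linearly independent and a
non-degenerate zero of a Khovanskii system over ℚ ⇒ trdeg_ℚ ℚ(s, e^s) ≥ n (card R3's restricted
class, as vectors). -/
@[route_item "route-Schanuel-DiophantineDichotomy"]
def KhovanskiiSchanuel : Prop :=
  ∀ (n : ℕ) (s : Fin n → ℂ), LinearIndependent ℚ s → (∃ g : Fin n → MvPolynomial (Fin n ⊕ Fin n) ℚ, (∀ i, MvPolynomial.aeval (Sum.elim s (Complex.exp ∘ s)) (g i) = 0) ∧ (Matrix.of fun i j => MvPolynomial.aeval (Sum.elim s (Complex.exp ∘ s)) (MvPolynomial.pderiv (Sum.inl j) (g i) + MvPolynomial.X (Sum.inr j) * MvPolynomial.pderiv (Sum.inr j) (g i))).det ≠ 0) → (n : Cardinal) ≤ Algebra.trdeg ℚ ↥(IntermediateField.adjoin ℚ (Set.range s ∪ Set.range (Complex.exp ∘ s)))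

/-- item stmt-Schanuel-14972 · crux · rank 2 · open · by planner
why it might fail: One free Khovanskii point with abnormally good algebraic approximations of UNBOUNDED height at BOUNDED degree (exponent ≥ 1/(n−1) in d, or super-linear in log H) kills it; at non-LW n=2 points it contains e⊥π / log2⊥log3 with a measure; for n≥3 no architecture beats (n+1)/(2n).
sources: Ably1994, Mahler1932, Philippon1999ActaArith, Bruiltet2002, Waldschmidt2004, NesterenkoPhilippon2001
[crux] EVENTUAL-IN-THE-HEIGHT simultaneous approximation type at every free Khovanskii point θ = (s,
e^s) ∈ ℂ²ⁿ, n ≥ 2: ∃ a < 1/(n−1), b, C > 0 such that for every degree budget d there is a threshold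
H₀(d) (arbitrary, ineffective allowed) with ‖γ − θ‖ ≥ exp(−C(dᵃ log H + dᵇ)) for all H ≥ H₀(d) and
all algebraic challengers γ with [ℚ(γ):ℚ] ≤ d whose coordinates are roots of non-zero integer
polynomials of degree ≤ d and height ≤ H. This is the WEAKEST form of the Diophantine input the
exponent race consumes (ApproximationRaceEv: fix Δ, let Y → ∞ — race compactness,
Cruxes/KhovanskiiApproxType/IdeatorK2Notes.md §A, re-derived by triage r1-2, r1-3); the all-heights
crux KhovanskiiApproxType (stmt-Schanuel-6116) implies it (TypedImpliesEv) and every line/negative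
lemma on 6116 serves it verbatim. LAYER MAP: (LW layer, s ∈ ℚ̄ⁿ, n = 2) THEOREM-GRADE — Ably1994 Thm
p.30 / Mahler1932 (LW measure, μ = m, any height-free penalty is harmless eventually) through the
LANDED transfer spine (relative Siegel in the challenger's ideal p76390, transfer p76504, slot
dichotomy p75181, LW layer p78384) gives a = A(μ+1)/(n(A+1)) = 3/4 < 1 (line
height-window-compactness stubs 1–3); (non-LW n = 2, e.g. -/
@[route_item "route-Schanuel-DiophantineDichotomy", crux]
def KhovanskiiApproxTypeEv : Prop :=
  ∀ (n : ℕ) (s : Fin n → ℂ), 2 ≤ n → LinearIndependent ℚ s → (∃ g : Fin n → MvPolynomial (Fin n ⊕ Fin n) ℚ, (∀ i, MvPolynomial.aeval (Sum.elim s (Complex.exp ∘ s)) (g i) = 0) ∧ (Matrix.of fun i j => MvPolynomial.aeval (Sum.elim s (Complex.exp ∘ s)) (MvPolynomial.pderiv (Sum.inl j) (g i) + MvPolynomial.X (Sum.inr j) * MvPolynomial.pderiv (Sum.inr j) (g i))).det ≠ 0) → ∃ a b C : ℝ, a < 1 / ((n : ℝ) - 1) ∧ 0 < C ∧ ∀ d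 : ℕ, ∃ H₀ : ℕ, ∀ (H : ℕ) (γ : Fin n ⊕ Fin n → ℂ), H₀ ≤ H → Module.finrank ℚ ↥(IntermediateField.adjoin ℚ (Set.range γ)) ≤ d → (∀ i, ∃ P : Polynomial ℤ, P ≠ 0 ∧ P.natDegree ≤ d ∧ (∀ k, |P.coeff k| ≤ (H : ℤ)) ∧ Polynomial.aeval (γ i) P = 0) → Real.exp (-(C * ((d : ℝ) ^ a * Real.log H + (d : ℝ) ^ b))) ≤ ‖γ - Sum.elim s (Complex.exp ∘ s)‖

/-- item stmt-Schanuel-6117 · crux · rank 3 · open · by planner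
why it might fail: for t ≥ 4 Philippon's AP1(d′=0) is a conjecture; t=2,3 printed (Philippon2000, not held) modulo the landed point transfer; load-bearing hyps kernel-checked (1 ≤ t, trdeg ≤ t sharp at every level, uniform c false, scale-exponent form false at Liouville points).
sources: NesterenkoPhilippon2001, LaurentRoy1999, Philippon2000, Waldschmidt2004, RoyWaldschmidt1997
[crux] Philippon's approximation property in transcendence degree t (all t ≥ 1), output-dependent
form in the (d, log H) currency: θ ∈ ℂ^ι with trdeg_ℚ ℚ(θ) ≤ t admits for all Y ≥ Δ ≥ c(θ) an
algebraic approximation γ with [ℚ(γ):ℚ] ≤ d ≤ (cΔ)^t, log H ≤ cYΔ^(t−1) and ‖γ − θ‖ ≤ exp(−(log H·Δ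
+ d·Y)/c) (card C2; GL326 Conj 15.31 / AP2 of NesterenkoPhilippon2001 Ch.4 §4; known t = 1
LaurentRoy1999 Thm 1 + intro, t = 2 Philippon2000 modulo lifting to the surface; open t ≥ 3).
[difficulty: open-problem] -/
@[route_item "route-Schanuel-DiophantineDichotomy", crux]
def ApproximationProperty : Prop :=
  ∀ (ι : Type) [Fintype ι] (θ : ι → ℂ) (t : ℕ), 1 ≤ t → Algebra.trdeg ℚ ↥(IntermediateField.adjoin ℚ (Set.range θ)) ≤ (t : Cardinal) → ∃ c : ℝ, 1 ≤ c ∧ ∀ Δ Y : ℝ, c ≤ Δ → Δ ≤ Y → ∃ (γ : ι → ℂ) (d H : ℕ), Module.finrank ℚ ↥(IntermediateField.adjoin ℚ (Set.range γ)) ≤ d ∧ (∀ i, ∃ P : Polynomial ℤ, P ≠ 0 ∧ P.natDegree ≤ d ∧ (∀ k, |P.coeff k| ≤ (H : ℤ)) ∧ Polynomial.aeval (γ i) P = 0) ∧ (d : ℝ) ≤ (c * Δ) ^ t ∧ Real.log H ≤ c * Y * Δ ^ (t - 1) ∧ ‖γ - θ‖ ≤ Real.exp (-((Real.log H * Δ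 + d * Y) / c))

/-- item stmt-Schanuel-6116 · support · rank 2 · open · by planner
why it might fail: All-heights form: beyond KhovanskiiApproxTypeEv it asserts the measure in the small-height window exp(d^{b0}) ≤ H < exp(exp(κ d log d)) at LW points (stub_lwWindow_two, beyond print); a super-Dirichlet approximation of e^β there refutes it but not the route.
sources: Ably1994, Mahler1932, RoyWaldschmidt1997, Waldschmidt2004, Bugeaud2004, NesterenkoPhilippon2001
[crux] measure of simultaneous algebraic approximation at every free Khovanskii point θ = (s, e^s) ∈
ℂ²ⁿ, n ≥ 2: ∃ a < 1/(n−1), b, C > 0 with ‖γ − θ‖ ≥ exp(−C(dᵃ log H + dᵇ)) for all algebraic points γ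
of degree [ℚ(γ):ℚ] ≤ d whose coordinates are roots of non-zero integer polynomials of degree ≤ d and
height ≤ H (card C1, pointwise form; expected truth a = 1/n). [difficulty: open-problem] -/
@[route_item "route-Schanuel-DiophantineDichotomy"]
def KhovanskiiApproxType : Prop :=
  ∀ (n : ℕ) (s : Fin n → ℂ), 2 ≤ n → LinearIndependent ℚ s → (∃ g : Fin n → MvPolynomial (Fin n ⊕ Fin n) ℚ, (∀ i, MvPolynomial.aeval (Sum.elim s (Complex.exp ∘ s)) (g i) = 0) ∧ (Matrix.of fun i j => MvPolynomial.aeval (Sum.elim s (Complex.exp ∘ s)) (MvPolynomial.pderiv (Sum.inl j) (g i) + MvPolynomial.X (Sum.inr j) * MvPolynomial.pderiv (Sum.inr j) (g i))).det ≠ 0) → ∃ a b C : ℝ, a < 1 / ((n : ℝ) - 1) ∧ 0 < C ∧ ∀ (d H : ℕ) (γ : Fin n ⊕ Fin n → ℂ), Module.finrank ℚ ↥(IntermediateField.adjoin ℚ (Set.range γ)) ≤ d → (∀ i, ∃ P : Polynomial ℤ, P ≠ 0 ∧ P.natDegree ≤ d ∧ (∀ k, |P.coeff k| ≤ (H : ℤ))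 ∧ Polynomial.aeval (γ i) P = 0) → Real.exp (-(C * ((d : ℝ) ^ a * Real.log H + (d : ℝ) ^ b))) ≤ ‖γ - Sum.elim s (Complex.exp ∘ s)‖

/-- item stmt-Schanuel-6118 · support · rank 4 · open · by planner
why it might fail: via EPiRace + the known t=1 approximation property it implies algebraic independence of e and π (open); separately each number has a=1+o(1) and even a=1 for π alone is the open 'π is an S-number' problem (Bugeaud2004 §8.3).
sources: Bugeaud2004, RoyWaldschmidt1997, LaurentRoy1999, Waldschmidt2000
[crux] the instance n = 2, s = (1, iπ) of KhovanskiiApproxType, stated for the pair (π, e): ∃ a < 1,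
b, C > 0 with max(|π − γ₁|, |e − γ₂|) ≥ exp(−C(dᵃ log H + dᵇ)) for all algebraic (γ₁, γ₂) with
[ℚ(γ₁, γ₂):ℚ] ≤ d and heights ≤ H; with ApproximationPropertyDegOne it gives e ⊥ π (EPiRace). [deps:
KhovanskiiApproxType] [difficulty: open-problem] -/
@[route_item "route-Schanuel-DiophantineDichotomy"]
def EPiSimultaneousType : Prop :=
  ∃ a b C : ℝ, a < 1 ∧ 0 < C ∧ ∀ (d H : ℕ) (γ : Fin 2 → ℂ), Module.finrank ℚ ↥(IntermediateField.adjoin ℚ (Set.range γ)) ≤ d → (∀ i, ∃ P : Polynomial ℤ, P ≠ 0 ∧ P.natDegree ≤ d ∧ (∀ k, |P.coeff k| ≤ (H : ℤ)) ∧ Polynomial.aeval (γ i) P = 0) → Real.exp (-(C * ((d : ℝ) ^ a * Real.log H + (d : ℝ) ^ b))) ≤ ‖γ - ![(Real.pi : ℂ), (Real.exp 1 : ℂ)]‖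

-- earlier ApproximationPropertyDegOne (stmt-Schanuel-6122, replaced 2026-08-15T16:38:42Z -> stmt-Schanuel-11037): retired by None — ∀ (ι : Type) [Fintype ι] (θ : ι → ℂ), Algebra.trdeg ℚ ↥(IntermediateField.adjoin ℚ (Set.range θ)) ≤ (1 : Cardinal) → ∃ c : ℝ, 1 ≤ c ∧ ∀ Δ Y : ℝ, c ≤ Δ → Δ ≤ Y → ∃ (γ : ι → ℂ) (d H : ℕ), Module.finrank ℚ ↥(IntermediateField.adjoin ℚ (Set.range γ)) ≤ d ∧ (∀ i, ∃ P : Polyn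
/-- item stmt-Schanuel-11037 · support · rank 9 · closed · proved by Summit.Schanuel.Schanuel.Theorems.approximationPropertyDegOne_proof (prover) · by planner
sources: LaurentRoy1999, Bugeaud2004, RoyWaldschmidt1997
[support] the case t = 1 of ApproximationProperty (KNOWN: LaurentRoy1999 intro + Thm 1 and §§5–6 for
points on a curve, Diaz 1997 = Bugeaud2004 Thm 8.11 for m = 1; to be vendored as a Literature named
fact plus the lifting from a transcendence basis, constants depending on θ). Grounded 2026-08-15
(g18-9, on the superseded copy stmt-Schanuel-6122): singleton-ι case =
`Literature.NumberTheory.DiophantineApproximation.Bugeaud2004_thm_8_11` (p52505, ACCEPTED, file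
Literature/NumberTheory/DiophantineApproximation/ApproximationByAlgebraicNumbers.lean) by
specialisation; general ι needs LaurentRoy1999 Thm 1 / lifting; refuter note: the ALL-SCALES
output-dependent form is required (Liouville θ at Y = Δ). Restated 1:1 (only `≤ (1 : Cardinal)` ↦ `≤
1`, Iff.rfl) to fix the route file's declaration order (EPiRace must come after this decl).
[difficulty: M] -/
@[route_item "route-Schanuel-DiophantineDichotomy"]
def ApproximationPropertyDegOne : Prop :=
  ∀ (ι : Type) [Fintype ι] (θ : ι → ℂ), Algebra.trdeg ℚ ↥(IntermediateField.adjoin ℚ (Set.range θ)) ≤ 1 → ∃ c : ℝ, 1 ≤ c ∧ ∀ Δ Y : ℝ, c ≤ Δ → Δ ≤ Y → ∃ (γ : ι → ℂ) (d H : ℕ), Module.finrank ℚ ↥(IntermediateField.adjoin ℚ (Set.range γ)) ≤ d ∧ (∀ i, ∃ P : Polynomial ℤ, P ≠ 0 ∧ P.natDegree ≤ d ∧ (∀ k, |P.coeff k| ≤ (H : ℤ)) ∧ Polynomial.aeval (γ i) P = 0) ∧ (d : ℝ) ≤ c * Δ ∧ Real.log H ≤ c * Y ∧ ‖γ - θ‖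 ≤ Real.exp (-((Real.log H * Δ + d * Y) / c))

-- earlier EPiRace (stmt-Schanuel-10737, replaced 2026-08-15T16:36:40Z -> stmt-Schanuel-11008): retired by None — ApproximationPropertyDegOne → EPiSimultaneousType → AlgebraicIndependent ℚ ![Real.exp 1, Real.pi]
-- earlier EPiRace (stmt-Schanuel-6123, replaced 2026-08-15T16:22:36Z -> stmt-Schanuel-10737): retired by None — ApproximationPropertyDegOne → EPiSimultaneousType → Literature.NumberTheory.Transcendental.ExpOnePiAlgebraicIndependent
/-- item stmt-Schanuel-11044 · support · rank 9 · closed · proved by Summit.Schanuel.Schanuel.Theorems.ePiRace_proof @ 7e2eb2714408 (prover) · by planner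
[support] the n = 2 race at s = (1, iπ). Hypothesis = the t = 1 approximation property AT the point
θ = (π, e) ∈ ℂ² (the instance ι = Fin 2, θ = ![π, e] of ApproximationPropertyDegOne, written out;
ApproximationPropertyDegOne ⇒ it by specialisation, so this is the rev-1 EPiRace with the minimal
hypothesis — Sketch.lean `epiRace_implies_old`): if trdeg ℚ(π, e) ≤ 1, take the approximants at Y =
Δ^q and contradict EPiSimultaneousType since a < 1. Conclusion `AlgebraicIndependent ℚ ![Real.exp 1,
Real.pi]` (= Literature.NumberTheory.Transcendental.ExpOnePiAlgebraicIndependent unfolded, Iff.rfl):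
e ⊥ π is an OUTPUT of the n = 2 layer, not a route dependency. [difficulty: provable-now] [sources:
RoyWaldschmidt1997, LaurentRoy1999] (re-filed by workitem add: the 16:36:40Z restate 10737→11008 was
logged but item 11008 was never created — farm bounce mid-edit) -/
@[route_item "route-Schanuel-DiophantineDichotomy"]
def EPiRace : Prop :=
  (Algebra.trdeg ℚ ↥(IntermediateField.adjoin ℚ (Set.range ![(Real.pi : ℂ), (Real.exp 1 : ℂ)])) ≤ (1 : Cardinal) → ∃ c : ℝ, 1 ≤ c ∧ ∀ Δ Y : ℝ, c ≤ Δ → Δ ≤ Y → ∃ (γ : Fin 2 → ℂ) (d H : ℕ), Module.finrank ℚ ↥(IntermediateField.adjoin ℚ (Set.range γ)) ≤ d ∧ (∀ i, ∃ P : Polynomial ℤ, P ≠ 0 ∧ P.natDegree ≤ d ∧ (∀ k, |P.coeff k| ≤ (H : ℤ)) ∧ Polynomial.aeval (γ i) P = 0) ∧ (d : ℝ) ≤ c * Δ ∧ Real.log H ≤ c * Y ∧ ‖γ - ![(Real.pi : ℂ), (Real.exp 1 : ℂ)]‖ ≤ Real.exp (-((Real.log H * Δ + d * Y) / c))) → EPiSimultaneousType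 → AlgebraicIndependent ℚ ![Real.exp 1, Real.pi]

/-- item stmt-Schanuel-14973 · support · rank 9 · closed · proved by Summit.Schanuel.Schanuel.Theorems.approximationRaceEv_proof (prover) · by planner
why it might fail: Provable now (two independent re-derivations); the only delicate step is the Northcott-type finiteness forcing H_Y → ∞ at bounded degree, which needs θ ∉ ℚ̄^{2n} (Hermite–Lindemann, in tree).
sources: NesterenkoPhilippon2001, LaurentRoy1999, Bugeaud2004
[support] the EVENTUAL exponent race (race compactness; replaces ApproximationRace as the glue of
`closes`): n = 0 trivial, n = 1 Hermite–Lindemann (`transcendental_exp_holds`), n ≥ 2: suppose trdeg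
ℚ(θ) ≤ t = n−1, get c from ApproximationProperty at (ι = Fin n ⊕ Fin n, θ, t); put τ = t·a < 1 and
FIX one Δ ≥ c with Δ^{1−τ} > 2c^{1+τ}C; D₀ := (cΔ)^t, H* := max_{d ≤ D₀} H₀(d); for integer Y ≥ Δ
the AP outputs (γ_Y, d_Y, H_Y) have 1 ≤ d_Y ≤ D₀, ‖γ_Y − θ‖ ≤ exp(−Y/c); the set of points all of
whose coordinates are roots of non-zero integer polynomials of degree ≤ D₀ and height < H* is FINITE
and misses θ (θ has a transcendental coordinate: s₀ ≠ 0 by linear independence, Hermite–Lindemann),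
so H_Y ≥ H* for Y large; then (log H_Y)(Δ/c − C d_Yᵃ) + d_Y Y/c ≤ C d_Yᵇ with Δ/c − C d_Yᵃ > 0
bounds Y — contradiction. Written out with all constants in
Cruxes/KhovanskiiApproxType/IdeatorK2Notes.md §A; re-derived independently in TRIAGE-r1-2.md and
TRIAGE-r1-3.md. Lean ingredients: finiteness of algebraic numbers of bounded degree and naive height
(finite set of integer polynomials × roots), `transcendental_exp_holds`, rpow/log algebra as in the
proved `approximationRace_proof`. [deps: Approximati -/
@[route_item "route-Schanuel-DiophantineDichotomy"]
def ApproximationRaceEv : Prop :=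
  ApproximationProperty → KhovanskiiApproxTypeEv → KhovanskiiSchanuel

/-- item stmt-Schanuel-14974 · support · rank 9 · closed · proved by Summit.Schanuel.Schanuel.Theorems.typedImpliesEv_proof (prover) · by planner
why it might fail: It cannot: proved in Sketch.lean (threshold H₀ := 0).
sources: Bugeaud2004
[support] bookkeeping (3 lines, proved in the promote seat's Sketch.lean `typedImpliesEv_holds`, H₀
:= 0): the all-heights measure KhovanskiiApproxType (stmt-Schanuel-6116, under attack by line
height-window-compactness whose skeleton concludes it BY NAME) implies the eventual crux — so a
proof of 6116, or of its LW layer, closes the corresponding layer of KhovanskiiApproxTypeEv, and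
every landed Negative lemma on 6116's hypotheses (LoadBearing p74852, NonUniform p74863,
WithoutKhovanskii*, SlotFloorDirichlet p75841, CodimOneDirichlet p84369) transfers to the eventual
crux (Diaz-type witnesses exist at every large scale). [deps: KhovanskiiApproxType,
KhovanskiiApproxTypeEv] [difficulty: provable-now] -/
@[route_item "route-Schanuel-DiophantineDichotomy"]
def TypedImpliesEv : Prop :=
  KhovanskiiApproxType → KhovanskiiApproxTypeEv

/-- item stmt-Schanuel-14975 · support · rank 9 · open · by planner
why it might fail: Contains e ⊥ π (via EPiRaceEv + the known t=1 property); a joint approximation of (π,e) of unbounded height at bounded degree beating every d^a, a<1, refutes it (each number alone has a=1: Diaz/Popken).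
sources: Bugeaud2004, Waldschmidt1978, RoyWaldschmidt1997, LaurentRoy1999, NesterenkoWaldschmidt1996
[support] the flagship instance s = (1, iπ) of KhovanskiiApproxTypeEv, stated for the pair (π, e)
(eventual form of EPiSimultaneousType, which implies it with H₀ := 0, Sketch.lean
`epiTyped_implies_ev`): ∃ a < 1, b, C > 0, ∀ d ∃ H₀ ∀ H ≥ H₀: max(|π − γ₁|, |e − γ₂|) ≥ exp(−C(dᵃ
log H + dᵇ)) for all algebraic (γ₁, γ₂) with [ℚ(γ₁, γ₂):ℚ] ≤ d, heights ≤ H. With the KNOWN t = 1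
approximation property at (π, e) it gives e ⊥ π (EPiRaceEv). Via the landed transfer spine it
follows from an eventual codimension-one measure log|Q(π, e)| ≥ −C(D^μ log H + D^K), H ≥ H₀(D), with
μ < 3 (floors A = 1 eventually: π by Waldschmidt1978 / NesterenkoWaldschmidt1996_thm_2_2 (vendored
p82623), e by Popken–Mahler, Bugeaud2004 p.83) — Dirichlet forces μ ≥ 2 (CodimOneDirichlet p84369),
so the target window is μ ∈ [2, 3): 'e and π are algebraically independent with a
Philippon-criterion-shaped measure, linear in log H'. Kill switch: ¬EPiSimultaneousTypeEv ⇒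
¬KhovanskiiApproxTypeEv (same instance argument as
Theorems/EPiSimultaneousType/Negative/OfKhovanskiiApproxType.lean). [deps: KhovanskiiApproxTypeEv,
EPiSimultaneousType] [difficulty: open-problem] -/
@[route_item "route-Schanuel-DiophantineDichotomy"]
def EPiSimultaneousTypeEv : Prop :=
  ∃ a b C : ℝ, a < 1 ∧ 0 < C ∧ ∀ d : ℕ, ∃ H₀ : ℕ, ∀ (H : ℕ) (γ : Fin 2 → ℂ), H₀ ≤ H → Module.finrank ℚ ↥(IntermediateField.adjoin ℚ (Set.range γ)) ≤ d → (∀ i, ∃ P : Polynomial ℤ, P ≠ 0 ∧ P.natDegree ≤ d ∧ (∀ k, |P.coeff k| ≤ (H : ℤ)) ∧ Polynomial.aeval (γ i) P = 0) → Real.exp (-(C * ((d : ℝ) ^ a * Real.log H + (d : ℝ) ^ b))) ≤ ‖γ - ![(Real.pi : ℂ), (Real.exp 1 : ℂ)]‖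

/-- item stmt-Schanuel-14976 · support · rank 9 · closed · proved by Summit.Schanuel.Schanuel.Theorems.ePiRaceEv_proof (prover) · by planner
why it might fail: Provable now (same fixed-Δ compactness as ApproximationRaceEv at t = 1; (π, e) ∉ ℚ̄² by the transcendence of e, in Mathlib/tree).
sources: RoyWaldschmidt1997, LaurentRoy1999, Bugeaud2004
[support] the flagship n = 2 race in eventual form: (the t = 1 approximation property AT θ = (π, e),
verbatim the hypothesis of the PROVED EPiRace stmt-Schanuel-11044, = the instance ι = Fin 2, θ =
![π, e] of ApproximationPropertyDegOne) → EPiSimultaneousTypeEv → AlgebraicIndependent ℚ ![e, π].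
Proof = race compactness at t = 1: if trdeg ℚ(π, e) ≤ 1, fix Δ with Δ^{1−a} > 2c^{1+a}C, let Y → ∞:
approximants have d ≤ cΔ (bounded), distance ≤ exp(−Y/c) → 0, so heights → ∞ ((π, e) ∉ ℚ̄²) past
max_{d ≤ cΔ} H₀(d), and (log H)(Δ/c − C dᵃ) + dY/c ≤ C dᵇ bounds Y. EPiRace follows from it
(Sketch.lean `epiRace_of_epiRaceEv`). Once ApproximationPropertyDegOne (stmt-Schanuel-11037; t = 1
slice being closed unconditionally by line orbit-interpolation-determinant of crux
ApproximationProperty, `slice_one_of`) lands, the tree holds 'EPiSimultaneousTypeEv → e ⊥ π'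
unconditionally. [deps: EPiSimultaneousTypeEv, ApproximationPropertyDegOne, EPiRace] [difficulty:
provable-now] -/
@[route_item "route-Schanuel-DiophantineDichotomy"]
def EPiRaceEv : Prop :=
  (Algebra.trdeg ℚ ↥(IntermediateField.adjoin ℚ (Set.range ![(Real.pi : ℂ), (Real.exp 1 : ℂ)])) ≤ (1 : Cardinal) → ∃ c : ℝ, 1 ≤ c ∧ ∀ Δ Y : ℝ, c ≤ Δ → Δ ≤ Y → ∃ (γ : Fin 2 → ℂ) (d H : ℕ), Module.finrank ℚ ↥(IntermediateField.adjoin ℚ (Set.range γ)) ≤ d ∧ (∀ i, ∃ P : Polynomial ℤ, P ≠ 0 ∧ P.natDegree ≤ d ∧ (∀ k, |P.coeff k| ≤ (H : ℤ)) ∧ Polynomial.aeval (γ i) P = 0) ∧ (d : ℝ) ≤ c * Δ ∧ Real.log H ≤ c * Y ∧ ‖γ - ![(Real.pi : ℂ), (Real.exp 1 : ℂ)]‖ ≤ Real.exp (-((Real.log H * Δ + d * Y) / c))) → EPiSimultaneousTypeEv → AlgebraicIndependent ℚ ![Real.exp 1, Real.pi]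

/-- item stmt-Schanuel-6119 · support · rank 9 · closed · proved by Summit.Schanuel.Schanuel.Theorems.approximationRace_proof (prover) · by planner
sources: NesterenkoPhilippon2001, LaurentRoy1999
[support] the exponent race: ApproximationProperty → KhovanskiiApproxType → KhovanskiiSchanuel (n =
0 trivial, n = 1 Hermite–Lindemann `transcendental_exp_holds`, n ≥ 2: apply AP with t = n−1 to θ =
(s, e^s), choose Y = Δ^q, contradiction for large Δ since (n−1)a < 1; elementary real analysis).
[difficulty: provable-now] -/
@[route_item "route-Schanuel-DiophantineDichotomy"]
def ApproximationRace : Prop :=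
  ApproximationProperty → KhovanskiiApproxType → KhovanskiiSchanuel

/-- item stmt-Schanuel-6120 · support · rank 9 · closed · proved by Summit.Schanuel.Schanuel.Theorems.khovanskiiReduction_proof @ d99e6b8a9f30 (prover) · by planner
sources: Kirby2010, Ax1971
[support] KhovanskiiSchanuel → Schanuel: take a counterexample x, a non-zero ℚ-subspace A ⊆ span x
minimising δ(A) = trdeg ℚ(A, e^A) − dim A over all subspaces (so δ(A) < 0 and δ(B) ≥ δ(A) for all B
⊆ A); for a basis a of A apply the tree's `khovanskii_dichotomy` to ℚ(a, e^a)/ℚ: case (b) gives an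
E-derivation D with Da ≠ 0, and Ax's theorem with rank term (`Ax1971.add_rank_le_trdeg`, constants
C_D = ker D) yields δ(A) ≥ δ(A ∩ C_D) + 1, contradicting minimality; case (a) makes a a free
Khovanskii point with trdeg < dim A, contradicting X (card R3, sharpened from coordinates to
vectors). [difficulty: provable-now] -/
@[route_item "route-Schanuel-DiophantineDichotomy", crux]
def KhovanskiiReduction : Prop :=
  KhovanskiiSchanuel → _root_.Schanuel

/-- item stmt-Schanuel-6121 · support · rank 9 · closed · proved by Summit.Schanuel.Schanuel.Theorems.khovanskiiLocalInverse_proof @ 074fd9a481a7 (prover) · by planner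
sources: Kirby2010, NesterenkoPhilippon2001
[support] quantitative inverse function theorem at a non-degenerate Khovanskii point (card R1, the
LW/HL transfer): Φ(z, y) = (g(z, y), y − e^z) is a local biholomorphism at θ = (s, e^s) (Schur
complement = exponential Jacobian), hence ‖γ − θ‖ ≤ c·max(maxᵢ|gᵢ(γ)|, maxⱼ|e^(γ_zⱼ) − γ_yⱼ|) for γ
within r of θ; so the approximation type of θ is the local simultaneous Hermite–Lindemann measure on
the Khovanskii variety, and any HL measure gives θ finite type. [difficulty: provable-now] -/
@[route_item "route-Schanuel-DiophantineDichotomy"]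
def KhovanskiiLocalInverse : Prop :=
  ∀ (n : ℕ) (s : Fin n → ℂ) (g : Fin n → MvPolynomial (Fin n ⊕ Fin n) ℚ), (∀ i, MvPolynomial.aeval (Sum.elim s (Complex.exp ∘ s)) (g i) = 0) → (Matrix.of fun i j => MvPolynomial.aeval (Sum.elim s (Complex.exp ∘ s)) (MvPolynomial.pderiv (Sum.inl j) (g i) + MvPolynomial.X (Sum.inr j) * MvPolynomial.pderiv (Sum.inr j) (g i))).det ≠ 0 → ∃ c r : ℝ, 0 < c ∧ 0 < r ∧ ∀ (γ : Fin n ⊕ Fin n → ℂ) (ε : ℝ), 0 ≤ ε → ‖γ - Sum.elim s (Complex.exp ∘ s)‖ < r → (∀ i, ‖MvPolynomial.aeval γ (g i)‖ ≤ ε) → (∀ j, ‖Complex.exp (γ (Sum.inl j)) - γ (Sum.inr j)‖ ≤ ε) → ‖γ - Sum.elim s (Complex.exp ∘ s)‖ ≤ c * ε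

-- earlier Assembly (stmt-Schanuel-6124, replaced 2026-08-16T06:47:20Z -> stmt-Schanuel-14920): proved by Summit.Schanuel.Schanuel.Theorems.diophantineDichotomy_assembly_proof @ 6606d10c17aa — ApproximationProperty → KhovanskiiApproxType → ApproximationRace → KhovanskiiReduction → _root_.Schanuel
/-- item stmt-Schanuel-14920 · assembly · rank 1 · closed · proved by Summit.Schanuel.Schanuel.Theorems.diophantineDichotomy_assembly_proof (prover) · by planner
sources: Kirby2010, NesterenkoPhilippon2001
[assembly] the route's assembly claim with the glue discharged: the two RANKED CRUXES — Philippon's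
approximation property in every transcendence degree t (ApproximationProperty, crux 3) and the
simultaneous-approximation measure with degree exponent a < 1/(n−1) at every free Khovanskii point
(KhovanskiiApproxType, crux 2) — decide Schanuel's conjecture. Content = the deciding chain of
`closes` (hRed (hRace hAP hAT)) with its two SUPPORT hypotheses supplied by their landed proofs: the
exponent race ApproximationRace (stmt-Schanuel-6119, PROVED:
Theorems/DiophantineDichotomyApproximationRace.lean `approximationRace_proof`) gives X =
KhovanskiiSchanuel, and the δ-minimal-counterexample reduction KhovanskiiReduction
(stmt-Schanuel-6120, PROVED: Theorems/DiophantineDichotomyKhovanskiiReduction.lean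
`khovanskiiReduction_proof`, Ax 1971 rank term + Khovanskii dichotomy) turns X into Schanuel.
Provable now, one line in a Theorems file importing those two modules: `fun hAP hAT =>
khovanskiiReduction_proof (approximationRace_proof hAP hAT)` (planner Sketch.lean
`assembly_of_supports`, lean rc 0, axioms propext/Classical.choice/Quot.sound). Restated 2026-08-16
(route-repair, ground-failed) f -/
@[route_item "route-Schanuel-DiophantineDichotomy"]
def Assembly : Prop :=
  ApproximationProperty → KhovanskiiApproxType → _root_.Schanuel

/-! D-0027 §2.1 — DECIDING THEOREM (planner-authored via `route open/edit --closes-file`; by planner-rbadge-Schanuel-DiophantineDichotomy-368da08b-g3-0 2026-08-16T07:27:14Z):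
its hypotheses are this route's items and its conclusion the sub-problem Statement (glue_lint), and it elaborates with this file. -/

/-- D-0027 §2.1 deciding theorem of route DiophantineDichotomy (crux-only repair 2026-08-16): hypotheses = the two ranked
CRUXES `ApproximationProperty`, `KhovanskiiApproxTypeEv` + the PROVED reduction `KhovanskiiReduction`; the EVENTUAL
EXPONENT RACE (formerly the open support `ApproximationRaceEv`) is proved inline — `n = 1` Hermite–Lindemann; `n ≥ 2`:
race compactness (fix ONE `Δ ≥ c` with `Δ^{1−tA} ≥ cC·c^{tA}`, `t = n − 1`, `A = max a 0`; the points whose coordinates are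
roots of non-zero integer polynomials of degree `≤ ⌊(cΔ)^t⌋₊` and height `≤ max H₀(d)` form a FINITE set
(`Polynomial.bUnion_roots_finite`) missing `θ = (s, e^s)` by Hermite–Lindemann, so for `Y → ∞` the approximants have
large height, the eventual measure applies, and `Δ log H + dY ≤ cC(dᵃ log H + dᵇ)` contradicts `cC dᵃ ≤ Δ`,
`cC dᵇ < Y ≤ dY`). (planner; this exact text lean-checked rc 0, axioms propext/Classical.choice/Quot.sound) -/
@[closes "route-Schanuel-DiophantineDichotomy"] theorem closes (hAP : ApproximationProperty) (hEv : KhovanskiiApproxTypeEv)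
    (hRed : KhovanskiiReduction) : _root_.Schanuel := by
  refine hRed ?_
  intro n s hs hg
  have HL := @Literature.NumberTheory.Transcendental.transcendental_exp_holds
  have one_le_of_transc : ∀ {L : IntermediateField ℚ ℂ} {w : ℂ}, w ∈ L → Transcendental ℚ w →
      (1 : Cardinal) ≤ Algebra.trdeg ℚ L := by
    intro L w hw ht
    haveI : Algebra.Transcendental ℚ L :=
      ⟨⟨⟨w, hw⟩, fun h => ht (IntermediateField.isAlgebraic_iff.mp h)⟩⟩
    exact Cardinal.one_le_iff_pos.mpr (_root_.trdeg_pos ℚ L)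
  have one_le_of_root : ∀ {P : Polynomial ℤ} {d : ℕ} {z : ℂ}, P ≠ 0 → P.natDegree ≤ d →
      Polynomial.aeval z P = 0 → 1 ≤ d := by
    intro P d z hP hdeg hz
    by_contra hd
    have hd0 : P.natDegree = 0 := by omega
    rw [Polynomial.eq_C_of_natDegree_eq_zero hd0, Polynomial.aeval_C, eq_intCast,
      Int.cast_eq_zero] at hz
    apply hP
    rw [Polynomial.eq_C_of_natDegree_eq_zero hd0, hz, map_zero]
  have algQ : ∀ {z : ℂ} {P : Polynomial ℤ}, P ≠ 0 → Polynomial.aeval z P = 0 → IsAlgebraic ℚ z :=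
    fun hP hz => IsAlgebraic.extendScalars (R := ℤ) (S := ℚ) (algebraMap ℤ ℚ).injective_int ⟨_, hP, hz⟩
  rcases Nat.lt_or_ge n 2 with hn | hn
  · interval_cases n
    · simp
    · -- `n = 1`: Hermite–Lindemann
      rw [Nat.cast_one]
      by_cases halg : IsAlgebraic ℚ (s 0)
      · exact one_le_of_transc (IntermediateField.subset_adjoin ℚ _ (Or.inr ⟨0, rfl⟩))
          (HL halg (hs.ne_zero 0))
      · exact one_le_of_transc (IntermediateField.subset_adjoin ℚ _ (Or.inl ⟨0, rfl⟩)) halg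
  · -- `n ≥ 2`: the EVENTUAL exponent race (race compactness: fix `Δ`, let `Y → ∞`)
    by_contra hlt
    rw [not_le] at hlt
    have key : ∀ S : Set ℂ, S = Set.range s ∪ Set.range (Complex.exp ∘ s) →
        Algebra.trdeg ℚ ↥(IntermediateField.adjoin ℚ S) ≤ ((n - 1 : ℕ) : Cardinal) := by
      rintro S rfl
      have h1 : (n : Cardinal) = Order.succ ((n - 1 : ℕ) : Cardinal) := by
        rw [Cardinal.succ_natCast]
        exact_mod_cast (by omega : n = n - 1 + 1)
      rw [h1] at hlt
      exact Order.lt_succ_iff.mp hlt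
    obtain ⟨c, hc1, hAP'⟩ := hAP (Fin n ⊕ Fin n) (Sum.elim s (Complex.exp ∘ s)) (n - 1)
      (by omega) (key _ (Set.Sum.elim_range _ _))
    obtain ⟨a, b, C, ha, hC, hEv'⟩ := hEv n s hn hs hg
    choose H₀ hH₀ using hEv'
    have hcpos : (0 : ℝ) < c := lt_of_lt_of_le one_pos hc1
    -- THE RACE (pure real analysis): one scale `Δ`, then every large `Y`
    have race : ∀ t : ℕ, 1 ≤ t → a < 1 / (t : ℝ) → ∃ Δ : ℝ, c ≤ Δ ∧ ∃ Y₁ : ℝ, 0 ≤ Y₁ ∧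
        ∀ Y : ℝ, Y₁ ≤ Y → ∀ d H : ℕ, 1 ≤ d → 1 ≤ H → (d : ℝ) ≤ (c * Δ) ^ t →
          c * (C * ((d : ℝ) ^ a * Real.log H + (d : ℝ) ^ b)) < Real.log H * Δ + d * Y := by
      intro t ht hat
      set A : ℝ := max a 0
      set B : ℝ := max b 0
      have htpos : (0 : ℝ) < t := by exact_mod_cast ht
      have hA0 : 0 ≤ A := le_max_right _ _
      have hB0 : 0 ≤ B := le_max_right _ _
      have hAt : (t : ℝ) * A < 1 := by
        have hA' : A < 1 / (t : ℝ) := max_lt hat (by positivity)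
        calc (t : ℝ) * A < t * (1 / t) := mul_lt_mul_of_pos_left hA' htpos
          _ = 1 := mul_one_div_cancel htpos.ne'
      set e : ℝ := 1 - t * A with he
      have hepos : 0 < e := by rw [he]; linarith
      set M : ℝ := c * C * c ^ ((t : ℝ) * A) with hM
      have hev : ∀ᶠ Δ in Filter.atTop, c ≤ Δ ∧ M ≤ Δ ^ e :=
        (Filter.eventually_ge_atTop c).and ((tendsto_rpow_atTop hepos).eventually_ge_atTop M)
      obtain ⟨Δ, hcΔ, hMΔ⟩ := hev.exists
      have hΔpos : 0 < Δ := lt_of_lt_of_le hcpos hcΔ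
      have hcΔpos : 0 < c * Δ := mul_pos hcpos hΔpos
      have hcC : 0 ≤ c * C := by positivity
      refine ⟨Δ, hcΔ, c * C * (c * Δ) ^ ((t : ℝ) * B) + 1, by positivity,
        fun Y hY₁Y d H hd hH hdle => ?_⟩
      have hd1 : (1 : ℝ) ≤ d := by exact_mod_cast hd
      have hd0 : (0 : ℝ) ≤ d := by positivity
      have hL : 0 ≤ Real.log H := Real.log_nonneg (by exact_mod_cast hH)
      have hda : (d : ℝ) ^ a ≤ (d : ℝ) ^ A :=
        Real.rpow_le_rpow_of_exponent_le hd1 (le_max_left _ _)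
      have hdb : (d : ℝ) ^ b ≤ (d : ℝ) ^ B :=
        Real.rpow_le_rpow_of_exponent_le hd1 (le_max_left _ _)
      have hpow : ∀ E : ℝ, 0 ≤ E → (d : ℝ) ^ E ≤ (c * Δ) ^ ((t : ℝ) * E) := fun E hE => by
        calc (d : ℝ) ^ E ≤ ((c * Δ) ^ t) ^ E := Real.rpow_le_rpow hd0 hdle hE
          _ = (c * Δ) ^ ((t : ℝ) * E) := by
            rw [← Real.rpow_natCast, ← Real.rpow_mul hcΔpos.le]
      have hI : c * C * (d : ℝ) ^ A ≤ Δ := by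
        calc c * C * (d : ℝ) ^ A ≤ c * C * (c * Δ) ^ ((t : ℝ) * A) :=
              mul_le_mul_of_nonneg_left (hpow A hA0) hcC
          _ = M * Δ ^ ((t : ℝ) * A) := by
              rw [Real.mul_rpow hcpos.le hΔpos.le, hM]; ring
          _ ≤ Δ ^ e * Δ ^ ((t : ℝ) * A) :=
              mul_le_mul_of_nonneg_right hMΔ (Real.rpow_nonneg hΔpos.le _)
          _ = Δ := by
              rw [← Real.rpow_add hΔpos, he, sub_add_cancel, Real.rpow_one]
      have hI' : c * C * (d : ℝ) ^ A * Real.log H ≤ Δ * Real.log H :=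
        mul_le_mul_of_nonneg_right hI hL
      have hY0 : 0 ≤ Y := le_trans (by positivity) hY₁Y
      have hII : c * C * (d : ℝ) ^ B < (d : ℝ) * Y := by
        calc c * C * (d : ℝ) ^ B ≤ c * C * (c * Δ) ^ ((t : ℝ) * B) :=
              mul_le_mul_of_nonneg_left (hpow B hB0) hcC
          _ < c * C * (c * Δ) ^ ((t : ℝ) * B) + 1 := lt_add_one _
          _ ≤ Y := hY₁Y
          _ ≤ (d : ℝ) * Y := le_mul_of_one_le_left hY0 hd1
      have h1 : c * C * ((d : ℝ) ^ a * Real.log H) ≤ c * C * ((d : ℝ) ^ A * Real.log H) :=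
        mul_le_mul_of_nonneg_left (mul_le_mul_of_nonneg_right hda hL) hcC
      have h2 : c * C * (d : ℝ) ^ b ≤ c * C * (d : ℝ) ^ B := mul_le_mul_of_nonneg_left hdb hcC
      have hexp : c * (C * ((d : ℝ) ^ a * Real.log H + (d : ℝ) ^ b)) =
          c * C * ((d : ℝ) ^ a * Real.log H) + c * C * (d : ℝ) ^ b := by ring
      rw [hexp]
      linarith [h1, h2, hI', hII]
    have ha' : a < 1 / ((n - 1 : ℕ) : ℝ) := by
      rw [Nat.cast_sub (by omega), Nat.cast_one]; exact ha
    obtain ⟨Δ, hcΔ, Y₁, hY₁0, hrace⟩ := race (n - 1) (by omega) ha'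
    have hΔpos : 0 < Δ := lt_of_lt_of_le hcpos hcΔ
    -- RACE COMPACTNESS: the degree cap `D₀` and the uniform height threshold `H⋆`
    obtain ⟨D₀, hD₀⟩ : ∃ D₀ : ℕ, ∀ d : ℕ, (d : ℝ) ≤ (c * Δ) ^ (n - 1) → d ≤ D₀ :=
      ⟨⌊(c * Δ) ^ (n - 1)⌋₊, fun d hd => Nat.le_floor hd⟩
    obtain ⟨Hstar, hHstar⟩ : ∃ Hstar : ℕ, ∀ d : ℕ, d ≤ D₀ → H₀ d ≤ Hstar :=
      ⟨(Finset.range (D₀ + 1)).sup H₀, fun d hd =>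
        Finset.le_sup (f := H₀) (Finset.mem_range.mpr (Nat.lt_succ_of_le hd))⟩
    obtain ⟨E, hE⟩ : ∃ E : Set (Fin n ⊕ Fin n → ℂ), ∀ γ, γ ∈ E ↔ ∀ i, ∃ P : Polynomial ℤ, P ≠ 0 ∧
        P.natDegree ≤ D₀ ∧ (∀ k, |P.coeff k| ≤ (Hstar : ℤ)) ∧ Polynomial.aeval (γ i) P = 0 :=
      ⟨{γ | ∀ i, ∃ P : Polynomial ℤ, P ≠ 0 ∧ P.natDegree ≤ D₀ ∧ (∀ k, |P.coeff k| ≤ (Hstar : ℤ)) ∧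
          Polynomial.aeval (γ i) P = 0}, fun γ => Iff.rfl⟩
    have hinj : Function.Injective (algebraMap ℤ ℂ) := (algebraMap ℤ ℂ).injective_int
    have hEfin : E.Finite := by
      have hR := Polynomial.bUnion_roots_finite (algebraMap ℤ ℂ) D₀
        (Set.finite_Icc (-(Hstar : ℤ)) (Hstar : ℤ))
      refine (Set.Finite.pi fun (_ : Fin n ⊕ Fin n) => hR).subset fun γ hγ => ?_
      rw [Set.mem_univ_pi]
      intro i
      obtain ⟨P, hP0, hdeg, hcoef, hroot⟩ := (hE γ).mp hγ i
      refine Set.mem_iUnion₂.mpr ⟨P, ⟨hdeg, fun k => Set.mem_Icc.mpr (abs_le.mp (hcoef k))⟩, ?_⟩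
      rw [Finset.mem_coe, Multiset.mem_toFinset, Polynomial.mem_roots_map_of_injective hinj hP0,
        ← Polynomial.aeval_def]
      exact hroot
    have hθE : Sum.elim s (Complex.exp ∘ s) ∉ E := by
      intro hθ
      obtain ⟨P, hP0, -, -, hPz⟩ := (hE _).mp hθ (Sum.inl ⟨0, by omega⟩)
      obtain ⟨Q, hQ0, -, -, hQz⟩ := (hE _).mp hθ (Sum.inr ⟨0, by omega⟩)
      exact HL (algQ hP0 hPz) (hs.ne_zero _) (algQ hQ0 hQz)
    have htend : Filter.Tendsto (fun Y : ℝ => Real.exp (-(Y / c))) Filter.atTop (nhds 0) :=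
      Real.tendsto_exp_atBot.comp
        (Filter.tendsto_neg_atTop_atBot.comp (Filter.tendsto_id.atTop_div_const hcpos))
    have hall : ∀ᶠ Y : ℝ in Filter.atTop, ∀ p ∈ E,
        Real.exp (-(Y / c)) < ‖p - Sum.elim s (Complex.exp ∘ s)‖ := by
      refine (hEfin.eventually_all).mpr fun p hp => htend.eventually (gt_mem_nhds ?_)
      rw [norm_pos_iff, sub_ne_zero]
      rintro rfl
      exact hθE hp
    obtain ⟨Y, hΔY, hY₁Y, hYsep⟩ :=
      ((Filter.eventually_ge_atTop Δ).and ((Filter.eventually_ge_atTop Y₁).and hall)).exists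
    obtain ⟨γ, d, H, hfin, hpoly, hdcap, -, hdist⟩ := hAP' Δ Y hcΔ hΔY
    obtain ⟨P₀, hP₀0, hP₀deg, -, hP₀z⟩ := hpoly (Sum.inl ⟨0, by omega⟩)
    have h1d : 1 ≤ d := one_le_of_root hP₀0 hP₀deg hP₀z
    have hY0 : 0 ≤ Y := le_trans hY₁0 hY₁Y
    have hdistY : ‖γ - Sum.elim s (Complex.exp ∘ s)‖ ≤ Real.exp (-(Y / c)) := by
      refine hdist.trans (Real.exp_le_exp.mpr ?_)
      have hlogH : 0 ≤ Real.log H := Real.log_natCast_nonneg H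
      have hYle : Y ≤ Real.log H * Δ + d * Y := by
        have hdY : Y ≤ (d : ℝ) * Y := le_mul_of_one_le_left hY0 (by exact_mod_cast h1d)
        nlinarith [mul_nonneg hlogH hΔpos.le]
      have := div_le_div_of_nonneg_right hYle hcpos.le
      linarith
    have hγE : γ ∉ E := fun hγ => absurd hdistY (not_le.mpr (hYsep γ hγ))
    have hHstar_lt : Hstar < H := by
      by_contra hH
      push Not at hH
      refine hγE ((hE γ).mpr fun i => ?_)
      obtain ⟨P, hP0, hPdeg, hPH, hPz⟩ := hpoly i
      exact ⟨P, hP0, hPdeg.trans (hD₀ d hdcap), fun k => (hPH k).trans (by exact_mod_cast hH), hPz⟩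
    have hlow := hH₀ d H γ ((hHstar d (hD₀ d hdcap)).trans hHstar_lt.le) hfin hpoly
    have h1H : 1 ≤ H := Nat.succ_le_of_lt (lt_of_le_of_lt (Nat.zero_le _) hHstar_lt)
    have hsand := neg_le_neg (Real.exp_le_exp.mp (hlow.trans hdist))
    rw [neg_neg, neg_neg, div_le_iff₀ hcpos] at hsand
    have hwin := hrace Y hY₁Y d H h1d h1H hdcap
    linarith

end Summit.Schanuel.Schanuel.Theses.DiophantineDichotomy
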